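import Literature.Barriers.CriticalPhenomena.SupercriticalSAWSpaceFillingTilesTheorem6
import Literature.Probability.RandomPlanarGeometry.SelfAvoidingWalkProofs
import HarnessLib

/-!
# Barrier, narrowed: Theorem 1 of Duminil-Copin–Kozma–Yadin pins δ-INDEPENDENT fugacity
# neighbourhoods only — a mesh-coordinated window `x(δ) → x_c` is not covered, and the window
# `x(δ) - x_c = o(δ²)` is provably equivalent to the sub-problem

Barrier catalogue `Literature/Barriers/CriticalPhenomena/` (D-0021), companion of
`SupercriticalSAWSpaceFilling` (= Theorem 1 of H. Duminil-Copin, G. Kozma, A. Yadin,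
*Supercritical self-avoiding walks are space-filling*, Ann. IHP Probab. Stat. 50 (2014) 315–326,
arXiv:1110.3074 — PROVED in the tree, `SupercriticalSAWSpaceFilling_holds` of
`…TilesTheorem6`, axioms `propext, Classical.choice, Quot.sound`; its `blocks:` line is the
theorem `SupercriticalSAWSpaceFilling.not_robustSAWScalingLimit` of `…Refutation`, modulo the two
SLE_{8/3} named facts `sle_restriction_eightThirds` [LSW03, Thm 6.1] and
`ae_isSimpleTrace_sleTrace_of_le_four` [RS05, Thm 6.1]). Outcome of the barrier audit of
2026-08-15 (refuter, D-0021 "barrier-audit"): **the statement is confirmed (proved), the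
catalogued technique class is narrowed.**

## What the audit found

The catalogued `technique_class` reads "fugacity-robust open-condition-in-x … equivalently any
argument insensitive to replacing `x_c = 1/μ(ℤ²)` … by nearby values", and `blocks:` "any form of
the sub-problem whose hypotheses are open in the fugacity". What Theorem 1 (even in its proved,
effective form) obstructs is narrower on three counts.

1. **Fixed `x` only.** Theorem 1 is printed and proved for a FIXED `x > 1/μ` as `δ → 0`: "For
   every `x > 1/μ`, there exist `ξ = ξ(x) > 0` and `c = c(x) > 0` such that … `→ 0` when
   `δ → 0`" (p. 2); all constants come from the box size `m = m(x)` of Proposition 3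
   (`limsup_m Z_m(x) = ∞` for `x > 1/μ`, p. 4) through Theorem 6 ("there exists `m = m(x)` and
   `c(x) > 0` … `≤ C(x,Ω) δ⁻² e^{-c(x)λ}`", tube `Γ_δ^{6m}`, p. 6), with no uniformity as
   `x ↓ 1/μ`. Nothing is said about a mesh-dependent fugacity `x(δ) → x_c`. So what is blocked is
   a CONCLUSION (`SAWScalingLimitAt x`, SLE_{8/3} convergence) asserted on a δ-INDEPENDENT
   neighbourhood of `x_c` — `RobustSAWScalingLimit`, and more generally every window-robust
   version `WindowRobustSAWScalingLimit w` whose window is eventually `≥ η > 0`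
   (`not_windowRobustSAWScalingLimit_of_eventually_le`, from `DKY2014_thm1_holds` and the two
   SLE facts). A diagonal argument extracts slightly more from Theorem 1: SOME window
   `w₀(δ) → 0⁺` is blocked (`exists_window_tendsto_zero_not_windowRobust`: along a diagonal
   schedule through `x_k = x_c + 1/(k+1)` the disk walk is still space-filling), but its rate is
   inexplicit — it is governed by the thresholds of Theorem 1, i.e. by `m(x)`, `ξ(x) = 6m(x)`,
   `c(x)` as `x ↓ 1/μ` — so the reach of the barrier into shrinking windows is a RATE question.
2. **Sub-volume windows are provably harmless.** A supercritical walk has "length of order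
   `1/δ²`" (p. 8, before Problem 9) and trivially every SAW of `Ω_δ` has `|γ| ≤ |Ω_δ| = O(δ⁻²)`
   steps; hence for a schedule with `x(δ) - x_c = o(δ²)` the laws `P_{x(δ)}` and `P_{x_c}` are
   mutually bounded by `e^{±o(1)}` and have the same limits in law
   (`tendsto_integral_lawAt_sub_integral_law`, `convergesInLawToSLE_along_iff`): the
   window-robust strengthening with any window `0 ≤ w(δ) = o(δ²)` is EQUIVALENT to the
   sub-problem (`windowRobustSAWScalingLimit_iff`), so no theorem about supercritical fugacities
   can obstruct it. Between `δ²` and `o(1)` no theorem of the source or of the tree decides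
   anything; the conjectural crossover is the near-critical window `|x - x_c| ≍ δ^{4/3}`
   (a critical walk of diameter `1` has `≍ δ^{-1/ν}` steps, `ν = 3/4` [LSW04, p. 17,
   Prediction 2]), which is exactly where the off-critical programme lives: "one has to tend the
   perturbation parameter to its critical value in a coordinated way with the lattice mesh, so
   that the mass does not blow up in the scaling limit" [MS10, p. 4], the massive deformation of
   the `O(N)` parafermionic observable "whose massive counterpart corresponds to perturbation of
   `x ≈ x_c`. Then tending mass to `∞` we should arrive to the second critical regime … does
   massive SLE₃ tend to SLE₆?" (for `N = 0`: SLE_{8/3} and SLE₈) and "Can massive observables …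
   help to understand the critical ones?" [MS10, p. 8, Questions 4.12–4.13]; the off-critical
   Duminil-Copin–Smirnov identity with mass term `(1 - x/x_c)` valid at every `x`
   [PdGGL12, Lemma 3, p. 4].
3. **"No closed formula for `μ(ℤ²)`" is immaterial.** `x_c = (infₙ c_{n+1}^{1/(n+1)})⁻¹` is a
   definite real number and arguments use it symbolically — Theorem 1 itself does, as do
   Hammersley–Welsh and its improvement AT `x_c` by the very polygon-insertion mechanism of the
   source (`|SAW_n| ≤ e^{n^{1/2-ε}} μⁿ` for infinitely many `n` on `ℤ²`, all large `n` on `ℍ`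
   [DGHM20, Thms 1.2–1.3, p. 3]): the entropy mechanism of §3 is not intrinsically supercritical,
   and hypotheses or identities that are open (analytic) in `x` are not obstructed — only
   conclusions robust in `x` are.

## Formal content (all proved; no new unproved fact)

`SAWScalingLimitAlong X` (SLE_{8/3} convergence along a fugacity schedule; constant schedule
`= SAWScalingLimitAt x`, `X ≡ x_c` `= SAWScalingLimit`, both `Iff.rfl`),
`WindowRobustSAWScalingLimit w` (along every schedule eventually within `w(δ)` of `x_c`; `.anti`,
`.sawScalingLimitAt`, `.sawScalingLimit`, `.robust`: a constant window `ε > 0` gives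
`RobustSAWScalingLimit`). Blocked half: `not_windowRobustSAWScalingLimit_of_eventually_le`,
`not_windowRobustSAWScalingLimit_const`; `IsSpaceFillingLaws` (space-filling for a general
family of laws) with the core portmanteau lemma `IsSpaceFillingLaws.not_convergesInLawToSLE`,
test balls `testBall` / `exists_testBall_subset`, thresholds `exists_thresholds`, the diagonal
schedule `exists_schedule_isSpaceFillingLaws`, and `exists_schedule_not_sawScalingLimitAlong`,
`exists_window_tendsto_zero_not_windowRobust` (a blocked window `w₀ → 0⁺`, modulo the SLE facts).
Unblocked half: `meshDomain_subset_box`,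
`ncard_meshDomain_le` (`|Ω_δ| ≤ (2⌈R/δ⌉+1)²` for `Ω ⊆ B̄(0,R)`), `length_le_ncard_meshDomain`
(`|γ| ≤ |Ω_δ|`), `weightAt_le_smul_weightAt` / `lawAt_le_smul_lawAt` (`P_y ≤ e^{2N|log y-log x|} P_x`),
`abs_integral_sub_integral_le` (two-sided portmanteau bookkeeping), `abs_integral_lawAt_sub_le`,
`IsSubVolumeSchedule` (`(X δ - x_c)/δ² → 0`), `tendsto_integral_lawAt_sub_integral_law`,
`convergesInLawToSLE_along_iff`, `sawScalingLimitAlong_iff`, `windowRobustSAWScalingLimit_iff`,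
and the narrowed barrier `SupercriticalSAWSpaceFillingNarrow` with
`SupercriticalSAWSpaceFillingNarrow_holds`.

Mathlib: `Measure.sum_apply`, `Measure.le_iff`, `ENNReal.mul_inv`, `integral_mono_measure`,
`integral_smul_nnreal_measure`, `Integrable.of_bound`, `SimpleGraph.Walk.adj_getVert_succ`,
`List.toFinset_card_of_nodup`, `Set.ncard_le_ncard`, `Real.log_le_sub_one_of_pos`,
`tendsto_of_tendsto_of_tendsto_of_le_of_le'`.

## References (page-level, audit 2026-08-15; pages of the arXiv versions)

* H. Duminil-Copin, G. Kozma, A. Yadin, Ann. IHP Probab. Stat. 50 (2014) 315–326,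
  arXiv:1110.3074: p. 2 (the three regimes; Theorem 1, "For every `x > 1/μ`, there exist
  `ξ = ξ(x) > 0` and `c = c(x) > 0`"), p. 4 (Proposition 3; Hammersley–Welsh
  `e^{-c√n}μⁿ ≤ b_n ≤ μⁿ`), p. 6 (Theorem 6, `m = m(x)`, tube `Γ_δ^{6m}`, bound
  `C(x,Ω)δ⁻² e^{-c(x)λ}`), p. 8 (length "of order `1/δ²`", Problems 9–10, Conjecture 11).
  [DuminilCopinKozmaYadin2014]
* G. F. Lawler, O. Schramm, W. Werner, *On the scaling limit of planar self-avoiding walk*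
  (2004), arXiv:math/0204277: p. 10 §3.2.1 (the exponent `ν`), p. 17 Prediction 2 ("The
  mean-square displacement exponent for SAWs and SAPs is `ν = 3/4`", from
  `dim SLE_{8/3} = 4/3`). [LawlerSchrammWerner2004SAW]
* N. Makarov, S. Smirnov, *Off-critical lattice models and massive SLEs*, XVIth ICMP (2010)
  362–371, arXiv:0909.5377: p. 4 (perturbation coordinated with the mesh), p. 8 Questions
  4.12–4.13 (`O(N)` model: `1/κ + 1/κ̃ = 1/2`, massive perturbation `x ≈ x_c`, mass `→ ∞` to
  reach the dense regime; massive observables to understand critical ones). [MakarovSmirnov2010]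
* A. Elvey Price, J. de Gier, A. J. Guttmann, A. Lee, J. Phys. A 45 (2012) 275002,
  arXiv:1203.2959: Lemma 2 (massive preholomorphicity), Lemma 3 (off-critical generating
  function identity with the factor `(1 - x/x_c)`), pp. 3–4. [PriceEtAl2012]
* H. Duminil-Copin, S. Ganguly, A. Hammond, I. Manolescu, Ann. Probab. 48 (2020) 1644–1692,
  arXiv:1809.00760: Theorems 1.2–1.3, p. 3 (Hammersley–Welsh with polygon insertion at
  `x_c`). [DuminilCopinGangulyHammondManolescu2020]
-/

noncomputable section

open MeasureTheory Filter Topology Metric Set Literature.Probability.LatticeModels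
  Literature.Probability.Percolation Literature.Probability.RandomPlanarGeometry
  Literature.Probability.RandomPlanarGeometry.SAW
open scoped ENNReal NNReal BoundedContinuousFunction

namespace Literature.Barriers.CriticalPhenomena

namespace SupercriticalSAW

/-! ### Fugacity schedules and fugacity windows -/

/-- **SLE_{8/3} convergence along a fugacity schedule `X`**: the sub-problem with the critical
fugacity replaced, at mesh `δ`, by `X δ` (so `SAWScalingLimitAt x` is the constant schedule and
the sub-problem is the schedule `X ≡ x_c`). [cite: DuminilCopinKozmaYadin2014, §1] -/
def SAWScalingLimitAlong (X : ℝ → ℝ) : Prop :=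
  ∀ (D : DobrushinDomain) (a b : ℝ → Site 2), IsEndpointApprox D a b →
    ConvergesInLawToSLE ((8 : ℝ≥0) / 3) D
      (fun δ (γ : DomainSAW D.carrier δ (a δ) (b δ)) => γ.curve)
      (fun δ => lawAt (X δ) D.carrier δ (a δ) (b δ))

/-- Constant schedules are `SAWScalingLimitAt`. [cite: DuminilCopinKozmaYadin2014, §1] -/
theorem sawScalingLimitAlong_const (x : ℝ) : SAWScalingLimitAlong (fun _ => x) ↔ SAWScalingLimitAt x :=
  Iff.rfl

/-- The schedule `X ≡ x_c` is the sub-problem itself. [cite: DuminilCopinKozmaYadin2014, §1 (x_c = 1/μ)] -/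
theorem sawScalingLimitAlong_criticalFugacity :
    SAWScalingLimitAlong (fun _ => criticalFugacity) ↔ SAWScalingLimit :=
  Iff.rfl

/-- **The window-robust strengthening of the sub-problem** with window `w`: SLE_{8/3}
convergence along EVERY fugacity schedule staying within `w(δ)` of `x_c` for small `δ`. For a
constant window `w ≡ ε` this contains `RobustSAWScalingLimit`; for `w ≡ 0` (or any admissible
`w ≥ 0`) it contains the sub-problem. [cite: DuminilCopinKozmaYadin2014, §1] -/
def WindowRobustSAWScalingLimit (w : ℝ → ℝ) : Prop :=
  ∀ X : ℝ → ℝ, (∀ᶠ δ in 𝓝[>] (0 : ℝ), |X δ - criticalFugacity| ≤ w δ) → SAWScalingLimitAlong X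

/-- Narrower windows give weaker statements. [folklore] -/
theorem WindowRobustSAWScalingLimit.anti {w w' : ℝ → ℝ} (hle : ∀ᶠ δ in 𝓝[>] (0 : ℝ), w' δ ≤ w δ)
    (h : WindowRobustSAWScalingLimit w) : WindowRobustSAWScalingLimit w' :=
  fun X hX => h X (by filter_upwards [hX, hle] with δ h₁ h₂ using h₁.trans h₂)

/-- A window eventually containing the fixed fugacity `x` gives `SAWScalingLimitAt x`. [folklore] -/
theorem WindowRobustSAWScalingLimit.sawScalingLimitAt {w : ℝ → ℝ} {x : ℝ}
    (hx : ∀ᶠ δ in 𝓝[>] (0 : ℝ), |x - criticalFugacity| ≤ w δ) (h : WindowRobustSAWScalingLimit w) :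
    SAWScalingLimitAt x :=
  (sawScalingLimitAlong_const x).1 (h _ hx)

/-- Every window-robust version with an (eventually) non-negative window contains the
sub-problem. [folklore] -/
theorem WindowRobustSAWScalingLimit.sawScalingLimit {w : ℝ → ℝ}
    (hw : ∀ᶠ δ in 𝓝[>] (0 : ℝ), 0 ≤ w δ) (h : WindowRobustSAWScalingLimit w) : SAWScalingLimit :=
  sawScalingLimitAt_criticalFugacity.1 (h.sawScalingLimitAt (by simpa using hw))

/-- A constant positive window contains `RobustSAWScalingLimit` (the catalogued technique
class). [cite: DuminilCopinKozmaYadin2014, §1] -/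
theorem WindowRobustSAWScalingLimit.robust {ε : ℝ} (hε : 0 < ε)
    (h : WindowRobustSAWScalingLimit fun _ => ε) : RobustSAWScalingLimit :=
  ⟨ε, hε, fun _ hx => h.sawScalingLimitAt (Eventually.of_forall fun _ => hx.le)⟩

/-! ### What Theorem 1 blocks: every window that does not shrink to `0` -/

/-- **Blocked half (from Theorem 1, proved, and the two SLE_{8/3} facts).** If the window is
eventually at least a fixed `η > 0`, the constant supercritical schedule `x_c + η` is admissible,
and `SAWScalingLimitAt (x_c + η)` contradicts Theorem 1 of Duminil-Copin–Kozma–Yadin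
(`not_sawScalingLimitAt_of_DKY2014_thm1` with `DKY2014_thm1_holds`).
[cite: DuminilCopinKozmaYadin2014, Theorem 1] -/
theorem not_windowRobustSAWScalingLimit_of_eventually_le (h61 : sle_restriction_eightThirds)
    (h₆ : ae_isSimpleTrace_sleTrace_of_le_four (κ := (8 : ℝ≥0) / 3)) {w : ℝ → ℝ} {η : ℝ}
    (hη : 0 < η) (hw : ∀ᶠ δ in 𝓝[>] (0 : ℝ), η ≤ w δ) : ¬ WindowRobustSAWScalingLimit w := by
  intro h
  refine not_sawScalingLimitAt_of_DKY2014_thm1 DKY2014_thm1_holds h61 h₆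
    (x := criticalFugacity + η) (by linarith) (h.sawScalingLimitAt ?_)
  filter_upwards [hw] with δ hδ
  rwa [add_sub_cancel_left, abs_of_pos hη]

/-- In particular the constant windows — `RobustSAWScalingLimit` — are blocked.
[cite: DuminilCopinKozmaYadin2014, Theorem 1] -/
theorem not_windowRobustSAWScalingLimit_const (h61 : sle_restriction_eightThirds)
    (h₆ : ae_isSimpleTrace_sleTrace_of_le_four (κ := (8 : ℝ≥0) / 3)) {ε : ℝ} (hε : 0 < ε) :
    ¬ WindowRobustSAWScalingLimit fun _ => ε :=
  not_windowRobustSAWScalingLimit_of_eventually_le h61 h₆ hε (Eventually.of_forall fun _ => le_rfl)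

/-! ### What Theorem 1 cannot block: sub-volume windows `w(δ) = o(δ²)` -/

section Lattice

variable {Ω : Set ℂ} {δ : ℝ} {a b : Site 2}

/-- A bounded domain's discretisation lies in a lattice box: if `Ω ⊆ B̄(0, R)` then
`Ω_δ ⊆ {-⌈R/δ⌉, …, ⌈R/δ⌉}²`. [folklore] -/
theorem meshDomain_subset_box {R : ℝ} (hR : Ω ⊆ closedBall 0 R) (hδ : 0 < δ) :
    meshDomain Ω δ ⊆ ↑(box 2 ⌈R / δ⌉₊) := by
  intro v hv
  have hz := hR (meshDomain_subset_meshVertices Ω δ hv)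
  rw [mem_closedBall, dist_zero_right] at hz
  rw [Finset.mem_coe, mem_box]
  intro i
  have hcoord : |δ * ((v i : ℤ) : ℝ)| ≤ R := by
    fin_cases i
    · have := (Complex.abs_re_le_norm (meshPoint δ v)).trans hz
      rwa [meshPoint_re] at this
    · have := (Complex.abs_im_le_norm (meshPoint δ v)).trans hz
      rwa [meshPoint_im] at this
  rw [abs_mul, abs_of_pos hδ] at hcoord
  have h1 : |((v i : ℤ) : ℝ)| ≤ R / δ := by rw [le_div_iff₀ hδ, mul_comm]; exact hcoord
  have h2 : |((v i : ℤ) : ℝ)| ≤ ((⌈R / δ⌉₊ : ℕ) : ℝ) := h1.trans (Nat.le_ceil _)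
  have h3 : |v i| ≤ ((⌈R / δ⌉₊ : ℕ) : ℤ) := by exact_mod_cast h2
  constructor <;> linarith [(abs_le.1 h3).1, (abs_le.1 h3).2]

/-- Hence `|Ω_δ| ≤ (2⌈R/δ⌉ + 1)²`. [folklore] -/
theorem ncard_meshDomain_le {R : ℝ} (hR : Ω ⊆ closedBall 0 R) (hδ : 0 < δ) :
    (meshDomain Ω δ).ncard ≤ (2 * ⌈R / δ⌉₊ + 1) ^ 2 := by
  calc (meshDomain Ω δ).ncard ≤ (↑(box 2 ⌈R / δ⌉₊) : Set (Site 2)).ncard :=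
        Set.ncard_le_ncard (meshDomain_subset_box hR hδ) (Finset.finite_toSet _)
    _ = (2 * ⌈R / δ⌉₊ + 1) ^ 2 := by rw [Set.ncard_coe_finset, card_box]

/-- A SAW of `Ω_δ` has at most `|Ω_δ|` steps (its `|γ| + 1` vertices are distinct sites of
`Ω_δ`; a walk from a site outside `Ω_δ` is trivial). [folklore] -/
theorem length_le_ncard_meshDomain (hfin : (meshDomain Ω δ).Finite) (γ : DomainSAW Ω δ a b) :
    γ.length ≤ (meshDomain Ω δ).ncard := by
  by_cases ha : a ∈ meshDomain Ω δ
  · have hsub : ∀ u ∈ γ.walk.support, u ∈ meshDomain Ω δ := walk_support_subset_meshDomain γ.walk ha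
    have h1 : γ.walk.support.length = γ.length + 1 := SimpleGraph.Walk.length_support _
    have h2 : γ.walk.support.toFinset.card = γ.walk.support.length :=
      List.toFinset_card_of_nodup γ.isPath.support_nodup
    have h3 : (↑γ.walk.support.toFinset : Set (Site 2)) ⊆ meshDomain Ω δ := fun u hu =>
      hsub u (List.mem_toFinset.1 (Finset.mem_coe.1 hu))
    have h4 : γ.walk.support.toFinset.card ≤ (meshDomain Ω δ).ncard := by
      rw [← Set.ncard_coe_finset]
      exact Set.ncard_le_ncard h3 hfin
    omega
  · have h0 : γ.walk.length = 0 := by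
      by_contra hne
      have hadj := γ.walk.adj_getVert_succ (Nat.pos_of_ne_zero hne)
      rw [SimpleGraph.Walk.getVert_zero] at hadj
      exact ha (discreteDomainGraph_adj_iff.1 hadj).2.1
    simp [DomainSAW.length, h0]

/-! ### Comparing the laws at two fugacities -/

/-- The fugacity ratio over a walk of at most `N` steps: for `x, y > 0` and `n ≤ N`,
`yⁿ ≤ e^{N |log y - log x|} xⁿ`. [folklore] -/
theorem pow_le_exp_mul_pow {x y : ℝ} (hx : 0 < x) (hy : 0 < y) {n N : ℕ} (hn : n ≤ N) :
    y ^ n ≤ Real.exp (N * |Real.log y - Real.log x|) * x ^ n := by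
  have hxn : 0 < x ^ n := pow_pos hx n
  have key : y ^ n = Real.exp (n * (Real.log y - Real.log x)) * x ^ n := by
    rw [← Real.log_div hy.ne' hx.ne', Real.exp_nat_mul, Real.exp_log (div_pos hy hx), div_pow,
      div_mul_cancel₀ _ hxn.ne']
  rw [key]
  refine mul_le_mul_of_nonneg_right (Real.exp_le_exp.2 ?_) hxn.le
  calc (n : ℝ) * (Real.log y - Real.log x) ≤ n * |Real.log y - Real.log x| :=
        mul_le_mul_of_nonneg_left (le_abs_self _) (Nat.cast_nonneg _)
    _ ≤ N * |Real.log y - Real.log x| :=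
        mul_le_mul_of_nonneg_right (Nat.cast_le.2 hn) (abs_nonneg _)

/-- Weight domination: if every SAW of `Ω_δ` from `a` to `b` has at most `N` steps, then
`weightAt y ≤ e^{N |log y - log x|} · weightAt x` (`x, y > 0`). [folklore] -/
theorem weightAt_le_smul_weightAt {x y : ℝ} (hx : 0 < x) (hy : 0 < y) {N : ℕ}
    (hN : ∀ γ : DomainSAW Ω δ a b, γ.length ≤ N) :
    weightAt y Ω δ a b ≤
      ENNReal.ofReal (Real.exp (N * |Real.log y - Real.log x|)) • weightAt x Ω δ a b := by
  set K := ENNReal.ofReal (Real.exp (N * |Real.log y - Real.log x|))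
  refine Measure.le_iff.2 fun s hs => ?_
  rw [Measure.smul_apply, weightAt, weightAt, Measure.sum_apply _ hs, Measure.sum_apply _ hs,
    smul_eq_mul, ← ENNReal.tsum_mul_left]
  refine ENNReal.tsum_le_tsum fun γ => ?_
  rw [Measure.smul_apply, Measure.smul_apply, smul_eq_mul, smul_eq_mul, ← mul_assoc]
  refine mul_le_mul' ?_ le_rfl
  rw [← ENNReal.ofReal_mul (Real.exp_pos _).le]
  exact ENNReal.ofReal_le_ofReal (pow_le_exp_mul_pow hx hy (hN γ))

/-- Law domination from two-sided weight domination: `lawAt y ≤ K² · lawAt x`. [folklore] -/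
theorem lawAt_le_smul_lawAt {x y : ℝ} {K : ℝ≥0∞} (hK : K ≠ ∞)
    (hyx : weightAt y Ω δ a b ≤ K • weightAt x Ω δ a b)
    (hxy : weightAt x Ω δ a b ≤ K • weightAt y Ω δ a b) :
    lawAt y Ω δ a b ≤ (K * K) • lawAt x Ω δ a b := by
  unfold lawAt
  set Wx := weightAt x Ω δ a b
  set Wy := weightAt y Ω δ a b
  rcases eq_or_ne (Wy univ) 0 with hy0 | hy0
  · rw [Measure.measure_univ_eq_zero.1 hy0, smul_zero]
    exact bot_le
  rcases eq_or_ne (Wy univ) ∞ with hytop | hytop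
  · rw [hytop, ENNReal.inv_top, zero_smul]
    exact bot_le
  have hK0 : K ≠ 0 := by
    rintro rfl
    apply hy0
    have := Measure.le_iff'.1 hyx univ
    rwa [zero_smul, Measure.coe_zero, Pi.zero_apply, le_zero_iff] at this
  have hx0 : Wx univ ≠ 0 := by
    intro h
    apply hy0
    have := Measure.le_iff'.1 hyx univ
    rwa [Measure.smul_apply, smul_eq_mul, h, mul_zero, le_zero_iff] at this
  have hxtop : Wx univ ≠ ∞ := by
    intro h
    have := Measure.le_iff'.1 hxy univ
    rw [Measure.smul_apply, smul_eq_mul, h, top_le_iff] at this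
    exact ENNReal.mul_ne_top hK hytop this
  -- `(Wy univ)⁻¹ ≤ K (Wx univ)⁻¹`
  have hinv : (Wy univ)⁻¹ ≤ K * (Wx univ)⁻¹ := by
    have h1 : Wx univ ≤ K * Wy univ := by
      have := Measure.le_iff'.1 hxy univ
      rwa [Measure.smul_apply, smul_eq_mul] at this
    have h2 : (K * Wy univ)⁻¹ ≤ (Wx univ)⁻¹ := ENNReal.inv_le_inv' h1
    rw [ENNReal.mul_inv (Or.inl hK0) (Or.inl hK)] at h2
    calc (Wy univ)⁻¹ = K * (K⁻¹ * (Wy univ)⁻¹) := by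
          rw [← mul_assoc, ENNReal.mul_inv_cancel hK0 hK, one_mul]
      _ ≤ K * (Wx univ)⁻¹ := mul_le_mul' le_rfl h2
  refine Measure.le_iff'.2 fun s => ?_
  have hs : Wy s ≤ K * Wx s := by
    have := Measure.le_iff'.1 hyx s
    rwa [Measure.smul_apply, smul_eq_mul] at this
  rw [Measure.smul_apply, smul_eq_mul, Measure.smul_apply, Measure.smul_apply, smul_eq_mul,
    smul_eq_mul]
  calc (Wy univ)⁻¹ * Wy s ≤ (K * (Wx univ)⁻¹) * (K * Wx s) := mul_le_mul' hinv hs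
    _ = K * K * ((Wx univ)⁻¹ * Wx s) := by ring

/-- **Two-sided comparison of integrals.** If two zero-or-probability measures dominate each
other up to the factor `c ≥ 1`, then integrals of a function bounded by `M ≥ 0` differ by at
most `2M(c - 1)`. [folklore] -/
theorem abs_integral_sub_integral_le {T : Type*} [MeasurableSpace T] {P Q : Measure T}
    (hP : P = 0 ∨ IsProbabilityMeasure P) (hQ : Q = 0 ∨ IsProbabilityMeasure Q)
    {c : ℝ≥0} (hc : 1 ≤ c) (hPQ : P ≤ c • Q) (hQP : Q ≤ c • P)
    {g : T → ℝ} (hg : Measurable g) {M : ℝ} (hM0 : 0 ≤ M) (hM : ∀ t, |g t| ≤ M) :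
    |∫ t, g t ∂P - ∫ t, g t ∂Q| ≤ 2 * M * (c - 1) := by
  have hRHS : 0 ≤ 2 * M * ((c : ℝ) - 1) := by
    have : (1 : ℝ) ≤ c := by exact_mod_cast hc
    have : (0 : ℝ) ≤ (c : ℝ) - 1 := by linarith
    positivity
  -- the degenerate cases: one of the measures vanishes, hence both do
  have zero_of_le : ∀ {μ ν : Measure T}, μ ≤ c • ν → ν = 0 → μ = 0 := by
    intro μ ν h hν
    rw [hν, smul_zero] at h
    exact le_antisymm h bot_le
  rcases hP with hP | hP
  · rw [hP, zero_of_le hQP hP, integral_zero_measure, sub_self, abs_zero]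
    exact hRHS
  rcases hQ with hQ | hQ
  · rw [hQ, zero_of_le hPQ hQ, integral_zero_measure, sub_self, abs_zero]
    exact hRHS
  -- both are probability measures: one-sided bound, used twice
  have one_sided : ∀ {μ ν : Measure T} [IsProbabilityMeasure μ] [IsProbabilityMeasure ν],
      μ ≤ c • ν → ∫ t, g t ∂μ - ∫ t, g t ∂ν ≤ 2 * M * (c - 1) := by
    intro μ ν _ _ hμν
    have hgi : ∀ (ρ : Measure T) [IsFiniteMeasure ρ], Integrable g ρ := fun ρ _ =>
      Integrable.of_bound hg.aestronglyMeasurable M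
        (ae_of_all _ fun t => by rw [Real.norm_eq_abs]; exact hM t)
    have hhi : ∀ (ρ : Measure T) [IsFiniteMeasure ρ], Integrable (fun t => g t + M) ρ := fun ρ _ =>
      (hgi ρ).add (integrable_const M)
    -- `∫ (g + M) dμ ≤ c ∫ (g + M) dν`
    have hmono : ∫ t, (g t + M) ∂μ ≤ ∫ t, (g t + M) ∂(c • ν) :=
      integral_mono_measure hμν
        (ae_of_all _ fun t => show (0 : ℝ) ≤ g t + M by linarith [neg_le_of_abs_le (hM t)])
        (hhi (c • ν))
    rw [integral_smul_nnreal_measure] at hmono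
    have hμ : ∫ t, (g t + M) ∂μ = ∫ t, g t ∂μ + M := by
      rw [integral_add (hgi μ) (integrable_const M), integral_const, smul_eq_mul, probReal_univ,
        one_mul]
    have hν : ∫ t, (g t + M) ∂ν = ∫ t, g t ∂ν + M := by
      rw [integral_add (hgi ν) (integrable_const M), integral_const, smul_eq_mul, probReal_univ,
        one_mul]
    rw [hμ, hν, NNReal.smul_def, smul_eq_mul] at hmono
    -- `∫ g dν ≤ M`
    have hνM : ∫ t, g t ∂ν ≤ M := by
      have := integral_mono (hgi ν) (integrable_const M) fun t => le_of_abs_le (hM t)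
      rwa [integral_const, smul_eq_mul, probReal_univ, one_mul] at this
    have hc' : (0 : ℝ) ≤ (c : ℝ) - 1 := by
      have : (1 : ℝ) ≤ c := by exact_mod_cast hc
      linarith
    nlinarith [hνM, hmono, hc', hM0]
  rw [abs_sub_le_iff]
  exact ⟨one_sided hPQ, by linarith [one_sided hQP]⟩

/-- **The laws at two fugacities are close when `N · |log y - log x|` is small**: for every test
function `g` bounded by `M ≥ 0` on SAWs of `Ω_δ` from `a` to `b`, all of length `≤ N`,
`|∫ g dP_y - ∫ g dP_x| ≤ 2M (e^{2N|log y - log x|} - 1)`. [folklore] -/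
theorem abs_integral_lawAt_sub_le {x y : ℝ} (hx : 0 < x) (hy : 0 < y) {N : ℕ}
    (hN : ∀ γ : DomainSAW Ω δ a b, γ.length ≤ N) {g : DomainSAW Ω δ a b → ℝ} {M : ℝ} (hM0 : 0 ≤ M)
    (hM : ∀ γ, |g γ| ≤ M) :
    |∫ γ, g γ ∂lawAt y Ω δ a b - ∫ γ, g γ ∂lawAt x Ω δ a b| ≤
      2 * M * (Real.exp (2 * (N * |Real.log y - Real.log x|)) - 1) := by
  set L : ℝ := N * |Real.log y - Real.log x| with hL
  have hL0 : 0 ≤ L := by positivity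
  obtain ⟨k, hk⟩ : ∃ k : ℝ≥0, (k : ℝ) = Real.exp L := ⟨⟨Real.exp L, (Real.exp_pos L).le⟩, rfl⟩
  have hkK : ENNReal.ofReal (Real.exp L) = (k : ℝ≥0∞) := by
    rw [← hk, ENNReal.ofReal_coe_nnreal]
  have hyx : weightAt y Ω δ a b ≤ (k : ℝ≥0∞) • weightAt x Ω δ a b := by
    rw [← hkK]; exact weightAt_le_smul_weightAt hx hy hN
  have hxy : weightAt x Ω δ a b ≤ (k : ℝ≥0∞) • weightAt y Ω δ a b := by
    rw [← hkK, hL, ← abs_sub_comm]; exact weightAt_le_smul_weightAt hy hx hN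
  have h1 := lawAt_le_smul_lawAt (K := k) ENNReal.coe_ne_top hyx hxy
  have h2 := lawAt_le_smul_lawAt (K := k) ENNReal.coe_ne_top hxy hyx
  have hkk : ((k : ℝ≥0∞) * k) = ((k * k : ℝ≥0) : ℝ≥0∞) := by rw [ENNReal.coe_mul]
  rw [hkk, ← ENNReal.smul_def] at h1 h2
  have hc : 1 ≤ k * k := by
    have h1k : 1 ≤ k := by
      rw [← NNReal.coe_le_coe, NNReal.coe_one, hk]
      exact Real.one_le_exp hL0
    exact one_le_mul h1k h1k
  have key := abs_integral_sub_integral_le (lawAt_eq_zero_or_isProbabilityMeasure y Ω δ a b)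
    (lawAt_eq_zero_or_isProbabilityMeasure x Ω δ a b) hc h1 h2 (DomainSAW.measurable_of_top g) hM0 hM
  have hexp : ((k * k : ℝ≥0) : ℝ) = Real.exp (2 * L) := by
    rw [NNReal.coe_mul, hk, ← Real.exp_add]; ring_nf
  rwa [hexp] at key

end Lattice

/-! ### Sub-volume schedules: `x(δ) - x_c = o(δ²)` is as good as `x = x_c` -/

/-- A **sub-volume fugacity schedule**: `X(δ) - x_c = o(δ²)` as `δ → 0⁺` (the perturbation is
invisible to every walk of the `O(δ⁻²)`-site domain `Ω_δ`). [folklore] -/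
def IsSubVolumeSchedule (X : ℝ → ℝ) : Prop :=
  Tendsto (fun δ => (X δ - criticalFugacity) / δ ^ 2) (𝓝[>] 0) (𝓝 0)

/-- The critical schedule is sub-volume. [folklore] -/
theorem isSubVolumeSchedule_const : IsSubVolumeSchedule fun _ => criticalFugacity := by
  simp only [IsSubVolumeSchedule, sub_self, zero_div]
  exact tendsto_const_nhds

/-- A schedule within a window `w = o(δ²)` is sub-volume. [folklore] -/
theorem isSubVolumeSchedule_of_window {w X : ℝ → ℝ}
    (hw : Tendsto (fun δ => w δ / δ ^ 2) (𝓝[>] 0) (𝓝 0))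
    (hX : ∀ᶠ δ in 𝓝[>] (0 : ℝ), |X δ - criticalFugacity| ≤ w δ) : IsSubVolumeSchedule X := by
  have hw' : Tendsto (fun δ => |w δ / δ ^ 2|) (𝓝[>] 0) (𝓝 0) :=
    (tendsto_zero_iff_abs_tendsto_zero _).1 hw
  refine (tendsto_zero_iff_abs_tendsto_zero _).2 ?_
  refine tendsto_of_tendsto_of_tendsto_of_le_of_le' tendsto_const_nhds hw'
    (Eventually.of_forall fun δ => abs_nonneg _) ?_
  filter_upwards [hX, self_mem_nhdsWithin] with δ hδ hδ0
  show |(X δ - criticalFugacity) / δ ^ 2| ≤ |w δ / δ ^ 2|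
  rw [abs_div, abs_div, abs_of_pos (pow_pos (mem_Ioi.1 hδ0) 2)]
  exact div_le_div_of_nonneg_right (hδ.trans (le_abs_self _)) (pow_pos (mem_Ioi.1 hδ0) 2).le

/-- **Along a sub-volume schedule the test integrals against the fugacity-`X(δ)` law and the
critical law are asymptotically equal**, for every bounded domain `Ω`, all endpoints and every
uniformly bounded family of test functions: `|Ω_δ| · |log X(δ) - log x_c| = O(δ⁻²) · o(δ²) → 0`.
[folklore] -/
theorem tendsto_integral_lawAt_sub_integral_law {X : ℝ → ℝ} (hX : IsSubVolumeSchedule X)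
    {Ω : Set ℂ} (hΩ : Bornology.IsBounded Ω) (a b : ℝ → Site 2)
    (g : ∀ δ : ℝ, DomainSAW Ω δ (a δ) (b δ) → ℝ) {M : ℝ} (hM0 : 0 ≤ M) (hM : ∀ δ γ, |g δ γ| ≤ M) :
    Tendsto (fun δ => ∫ γ, g δ γ ∂lawAt (X δ) Ω δ (a δ) (b δ) - ∫ γ, g δ γ ∂law Ω δ (a δ) (b δ))
      (𝓝[>] 0) (𝓝 0) := by
  obtain ⟨hxc, -⟩ := criticalFugacity_pos_lt_one'
  obtain ⟨R, hR⟩ := (Metric.isBounded_iff_subset_closedBall (0 : ℂ)).1 hΩ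
  -- WLOG `R ≥ 0`
  obtain ⟨R, hR0, hR⟩ : ∃ R', 0 ≤ R' ∧ Ω ⊆ closedBall 0 R' :=
    ⟨max R 0, le_max_right _ _, hR.trans (closedBall_subset_closedBall (le_max_left _ _))⟩
  -- the exponent `E δ = 2 N_δ |log X δ - log x_c|` tends to `0`
  set C : ℝ := 2 * (2 * R + 3) ^ 2 * (2 / criticalFugacity) with hC
  have hsmall : ∀ᶠ δ in 𝓝[>] (0 : ℝ), |X δ - criticalFugacity| ≤ criticalFugacity / 2 := by
    have h1 : Tendsto (fun δ : ℝ => (X δ - criticalFugacity) / δ ^ 2 * δ ^ 2) (𝓝[>] 0) (𝓝 (0 * 0 ^ 2)) :=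
      hX.mul ((continuous_pow 2).tendsto' 0 _ (by simp) |>.mono_left nhdsWithin_le_nhds)
    rw [zero_mul] at h1
    have h2 : Tendsto (fun δ : ℝ => X δ - criticalFugacity) (𝓝[>] 0) (𝓝 0) := by
      refine h1.congr' ?_
      filter_upwards [self_mem_nhdsWithin] with δ hδ
      rw [div_mul_cancel₀ _ (pow_pos (mem_Ioi.1 hδ) 2).ne']
    have h3 := (tendsto_zero_iff_abs_tendsto_zero _).1 h2
    exact h3.eventually (Iic_mem_nhds (by positivity))
  have hbound : ∀ᶠ δ in 𝓝[>] (0 : ℝ),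
      |∫ γ, g δ γ ∂lawAt (X δ) Ω δ (a δ) (b δ) - ∫ γ, g δ γ ∂law Ω δ (a δ) (b δ)| ≤
        2 * M * (Real.exp (C * (|X δ - criticalFugacity| / δ ^ 2)) - 1) := by
    filter_upwards [hsmall, Ioo_mem_nhdsGT (zero_lt_one' ℝ)] with δ hδs hδ
    have hδ0 : 0 < δ := hδ.1
    have hXpos : 0 < X δ := by
      have := neg_le_of_abs_le hδs
      linarith
    -- lengths are at most `N = (2⌈R/δ⌉+1)²`
    set N : ℕ := (2 * ⌈R / δ⌉₊ + 1) ^ 2 with hN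
    have hlen : ∀ γ : DomainSAW Ω δ (a δ) (b δ), γ.length ≤ N := fun γ =>
      (length_le_ncard_meshDomain (meshDomain_finite hΩ hδ0) γ).trans (ncard_meshDomain_le hR hδ0)
    have key := abs_integral_lawAt_sub_le (Ω := Ω) (δ := δ) hxc hXpos hlen hM0 (hM δ)
    rw [← lawAt_criticalFugacity]
    refine key.trans (mul_le_mul_of_nonneg_left ?_ (by positivity))
    refine sub_le_sub_right (Real.exp_le_exp.2 ?_) 1
    -- `2 N |log X - log x_c| ≤ C |X - x_c| / δ²`
    have hNle : (N : ℝ) ≤ (2 * R + 3) ^ 2 / δ ^ 2 := by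
      rw [hN]
      push_cast
      have h3 : ((⌈R / δ⌉₊ : ℕ) : ℝ) < R / δ + 1 := Nat.ceil_lt_add_one (by positivity)
      have h4 : (2 * ((⌈R / δ⌉₊ : ℕ) : ℝ) + 1) ≤ (2 * R + 3) / δ := by
        rw [le_div_iff₀ hδ0]
        have : R / δ * δ = R := div_mul_cancel₀ R hδ0.ne'
        nlinarith [hδ.2]
      have h5 : (0 : ℝ) ≤ 2 * ((⌈R / δ⌉₊ : ℕ) : ℝ) + 1 := by positivity
      calc (2 * ((⌈R / δ⌉₊ : ℕ) : ℝ) + 1) ^ 2 ≤ ((2 * R + 3) / δ) ^ 2 := pow_le_pow_left₀ h5 h4 2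
        _ = (2 * R + 3) ^ 2 / δ ^ 2 := by rw [div_pow]
    have hlog : |Real.log (X δ) - Real.log criticalFugacity| ≤
        2 / criticalFugacity * |X δ - criticalFugacity| := by
      rw [abs_sub_le_iff]
      constructor
      · -- `log X - log x_c ≤ (X - x_c)/x_c`
        have h := Real.log_le_sub_one_of_pos (div_pos hXpos hxc)
        rw [Real.log_div hXpos.ne' hxc.ne'] at h
        have e : X δ / criticalFugacity - 1 = (X δ - criticalFugacity) / criticalFugacity := by
          field_simp
        rw [e] at h
        refine h.trans ?_
        rw [div_eq_mul_inv, mul_comm, ← div_eq_inv_mul]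
        calc (X δ - criticalFugacity) / criticalFugacity ≤ |X δ - criticalFugacity| / criticalFugacity :=
              div_le_div_of_nonneg_right (le_abs_self _) hxc.le
          _ ≤ 2 / criticalFugacity * |X δ - criticalFugacity| := by
              rw [div_eq_mul_inv, mul_comm, div_eq_mul_inv]
              nlinarith [abs_nonneg (X δ - criticalFugacity), inv_pos.2 hxc]
      · -- `log x_c - log X ≤ (x_c - X)/X ≤ 2|X - x_c|/x_c`
        have h := Real.log_le_sub_one_of_pos (div_pos hxc hXpos)
        rw [Real.log_div hxc.ne' hXpos.ne'] at h
        have hX2 : criticalFugacity / 2 ≤ X δ := by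
          have := le_of_abs_le hδs
          have := neg_le_of_abs_le hδs
          linarith
        have e : criticalFugacity / X δ - 1 = (criticalFugacity - X δ) / X δ := by field_simp
        rw [e] at h
        refine h.trans ?_
        rw [div_le_iff₀ hXpos]
        have hab : criticalFugacity - X δ ≤ |X δ - criticalFugacity| := by
          rw [abs_sub_comm]; exact le_abs_self _
        have : 2 / criticalFugacity * |X δ - criticalFugacity| * X δ ≥
            2 / criticalFugacity * |X δ - criticalFugacity| * (criticalFugacity / 2) :=
          mul_le_mul_of_nonneg_left hX2 (by positivity)
        have e2 : 2 / criticalFugacity * |X δ - criticalFugacity| * (criticalFugacity / 2) =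
            |X δ - criticalFugacity| := by field_simp
        linarith
    calc 2 * ((N : ℝ) * |Real.log (X δ) - Real.log criticalFugacity|)
        ≤ 2 * ((2 * R + 3) ^ 2 / δ ^ 2 * (2 / criticalFugacity * |X δ - criticalFugacity|)) := by
          gcongr
      _ = C * (|X δ - criticalFugacity| / δ ^ 2) := by rw [hC]; field_simp
  -- the right-hand side tends to `0`
  have hlim : Tendsto (fun δ => 2 * M * (Real.exp (C * (|X δ - criticalFugacity| / δ ^ 2)) - 1))
      (𝓝[>] 0) (𝓝 0) := by
    have h1 : Tendsto (fun δ => |X δ - criticalFugacity| / δ ^ 2) (𝓝[>] 0) (𝓝 0) := by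
      have := (tendsto_zero_iff_abs_tendsto_zero _).1 hX
      refine this.congr' ?_
      filter_upwards [self_mem_nhdsWithin] with δ hδ
      show |(X δ - criticalFugacity) / δ ^ 2| = _
      rw [abs_div, abs_of_pos (pow_pos (mem_Ioi.1 hδ) 2)]
    have h2 : Tendsto (fun δ => Real.exp (C * (|X δ - criticalFugacity| / δ ^ 2)) - 1) (𝓝[>] 0)
        (𝓝 (Real.exp (C * 0) - 1)) :=
      ((Real.continuous_exp.tendsto _).comp (h1.const_mul C)).sub_const 1
    rw [mul_zero, Real.exp_zero, sub_self] at h2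
    simpa using h2.const_mul (2 * M)
  rw [tendsto_zero_iff_abs_tendsto_zero]
  exact tendsto_of_tendsto_of_tendsto_of_le_of_le' tendsto_const_nhds hlim
    (Eventually.of_forall fun δ => abs_nonneg _) hbound

/-- **Convergence in law to SLE_κ is the same along every sub-volume schedule as at `x_c`.**
[folklore] -/
theorem convergesInLawToSLE_along_iff {X : ℝ → ℝ} (hX : IsSubVolumeSchedule X) (κ : ℝ≥0)
    (D : DobrushinDomain) (a b : ℝ → Site 2) :
    ConvergesInLawToSLE κ D (fun δ (γ : DomainSAW D.carrier δ (a δ) (b δ)) => γ.curve)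
        (fun δ => lawAt (X δ) D.carrier δ (a δ) (b δ)) ↔
      ConvergesInLawToSLE κ D (fun δ (γ : DomainSAW D.carrier δ (a δ) (b δ)) => γ.curve)
        (fun δ => law D.carrier δ (a δ) (b δ)) := by
  have hmeas : ∀ (P : ∀ δ : ℝ, Measure (DomainSAW D.carrier δ (a δ) (b δ))),
      ∀ᶠ δ in 𝓝[>] (0 : ℝ), AEMeasurable (fun γ : DomainSAW D.carrier δ (a δ) (b δ) => γ.curve) (P δ) :=
    fun P => Eventually.of_forall fun δ => (DomainSAW.measurable_of_top _).aemeasurable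
  -- the test integrals differ by `o(1)`
  have hdiff : ∀ f : CurveClass ℂ →ᵇ ℝ,
      Tendsto (fun δ => ∫ γ, f γ.curve ∂lawAt (X δ) D.carrier δ (a δ) (b δ) -
        ∫ γ, f γ.curve ∂law D.carrier δ (a δ) (b δ)) (𝓝[>] 0) (𝓝 0) := fun f =>
    tendsto_integral_lawAt_sub_integral_law hX D.isBounded a b (fun δ γ => f γ.curve)
      (norm_nonneg f) fun δ γ => by
        rw [← Real.norm_eq_abs]; exact f.norm_coe_le_norm _
  constructor
  · rintro ⟨Γ, hΓ, -, hT⟩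
    refine ⟨Γ, hΓ, hmeas _, fun f => ?_⟩
    have := (hT f).sub (hdiff f)
    simpa using this
  · rintro ⟨Γ, hΓ, -, hT⟩
    refine ⟨Γ, hΓ, hmeas _, fun f => ?_⟩
    have := (hT f).add (hdiff f)
    simpa using this

/-- **Along a sub-volume schedule the scaling-limit statement is the sub-problem.** [folklore] -/
theorem sawScalingLimitAlong_iff {X : ℝ → ℝ} (hX : IsSubVolumeSchedule X) :
    SAWScalingLimitAlong X ↔ SAWScalingLimit :=
  forall₄_congr fun D a b _ => convergesInLawToSLE_along_iff hX _ D a b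

/-- **Unblocked half: a window `w = o(δ²)` (`w ≥ 0`) makes the window-robust strengthening
EQUIVALENT to the sub-problem** — no theorem about supercritical fugacities can separate them.
[folklore] -/
theorem windowRobustSAWScalingLimit_iff {w : ℝ → ℝ} (hw0 : ∀ᶠ δ in 𝓝[>] (0 : ℝ), 0 ≤ w δ)
    (hw : Tendsto (fun δ => w δ / δ ^ 2) (𝓝[>] 0) (𝓝 0)) :
    WindowRobustSAWScalingLimit w ↔ SAWScalingLimit :=
  ⟨fun h => h.sawScalingLimit hw0,
    fun h _ hX => (sawScalingLimitAlong_iff (isSubVolumeSchedule_of_window hw hX)).2 h⟩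

/-! ### Space-filling along a schedule, and the core lemma for a general family of laws -/

/-- The printed weak space-filling property for an arbitrary family of (finite) laws `P δ` on the
SAWs of `Ω_δ` from `A δ` to `B δ`. [cite: DuminilCopinKozmaYadin2014, §1 (When x > 1/μ)] -/
def IsSpaceFillingLaws (Ω : Set ℂ) (A B : ℝ → Site 2)
    (P : ∀ δ : ℝ, Measure (DomainSAW Ω δ (A δ) (B δ))) : Prop :=
  ∀ U : Set ℂ, IsOpen U → U ⊆ Ω → U.Nonempty →
    Tendsto (fun δ : ℝ => P δ {γ | ∀ v ∈ γ.walk.support, meshPoint δ v ∉ U}) (𝓝[>] 0) (𝓝 0)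

/-- For the constant-fugacity laws this is `IsSpaceFillingFamily`. [cite: DuminilCopinKozmaYadin2014, §1 (When x > 1/μ)] -/
theorem isSpaceFillingLaws_lawAt_iff {x : ℝ} {Ω : Set ℂ} {A B : ℝ → Site 2} :
    IsSpaceFillingLaws Ω A B (fun δ => lawAt x Ω δ (A δ) (B δ)) ↔ IsSpaceFillingFamily x Ω A B :=
  Iff.rfl

section Core

variable {κ : ℝ≥0} {D : DobrushinDomain} {A B : ℝ → Site 2}

/-- **Space-filling laws do not converge in law to a curve missing a ball** — the core lemma
`IsSpaceFillingFamily.not_convergesInLawToSLE` of `…Proofs` for an arbitrary family of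
zero-or-probability laws (same one-sided portmanteau proof). [cite: DuminilCopinKozmaYadin2014, §1 (When x > 1/μ)] -/
theorem IsSpaceFillingLaws.not_convergesInLawToSLE
    {P : ∀ δ : ℝ, Measure (DomainSAW D.carrier δ (A δ) (B δ))} [∀ δ, IsFiniteMeasure (P δ)]
    (hfill : IsSpaceFillingLaws D.carrier A B P)
    (hmiss : ∀ Γ : (ℝ≥0 → ℝ) → CurveClass ℂ, IsSLECurve κ D Γ →
      ∃ z : ℂ, ∃ r : ℝ, 0 < r ∧ ball z r ⊆ D.carrier ∧
        Literature.Probability.Process.preWienerMeasure {ω | Disjoint (ball z (2 * r)) (Γ ω).range} ≠ 0)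
    (hW : Literature.Probability.Process.isProjectiveLimit_preWienerMeasure) :
    ¬ ConvergesInLawToSLE κ D (fun δ (γ : DomainSAW D.carrier δ (A δ) (B δ)) => γ.curve) P := by
  haveI := Literature.Probability.Process.isProbabilityMeasure_preWienerMeasure hW
  rintro ⟨Γ, hΓ, -, hT⟩
  obtain ⟨z, r, hr, hball, hpos⟩ := hmiss Γ hΓ
  have hlim : Tendsto (fun δ => ∫ γ, missFunctional z r (DomainSAW.curve γ) ∂P δ) (𝓝[>] (0 : ℝ))
      (𝓝 (∫ ω, missFunctional z r (Γ ω) ∂Literature.Probability.Process.preWienerMeasure)) :=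
    hT (missFunctional z r)
  have hu : Tendsto (fun δ => (P δ {γ | ∀ v ∈ γ.walk.support, meshPoint δ v ∉ ball z r}).toReal)
      (𝓝[>] (0 : ℝ)) (𝓝 0) := by
    have h := (ENNReal.tendsto_toReal ENNReal.zero_ne_top).comp
      (hfill (ball z r) isOpen_ball hball ⟨z, mem_ball_self hr⟩)
    rwa [ENNReal.toReal_zero] at h
  have hzero : Tendsto (fun δ => ∫ γ, missFunctional z r (DomainSAW.curve γ) ∂P δ) (𝓝[>] (0 : ℝ))
      (𝓝 0) :=
    tendsto_of_tendsto_of_tendsto_of_le_of_le tendsto_const_nhds hu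
      (fun δ => integral_nonneg fun γ => missFunctional_nonneg _ _ _)
      (fun δ => integral_missFunctional_curve_le hr _)
  have hL : ∫ ω, missFunctional z r (Γ ω) ∂Literature.Probability.Process.preWienerMeasure = 0 :=
    tendsto_nhds_unique hlim hzero
  have hle := measureReal_le_integral_missFunctional
    (W := Literature.Probability.Process.preWienerMeasure) hΓ.aemeasurable hr (z := z)
  rw [hL] at hle
  exact absurd hle (not_le.2 (ENNReal.toReal_pos hpos (measure_ne_top _ _)))

/-- Corollary along a fugacity schedule: space-filling laws `P_{X(δ)}` along an endpoint
approximation refute `SAWScalingLimitAlong X`. [cite: DuminilCopinKozmaYadin2014, §1 (When x > 1/μ)] -/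
theorem not_sawScalingLimitAlong_of_isSpaceFillingLaws {X : ℝ → ℝ} (hAB : IsEndpointApprox D A B)
    (hfill : IsSpaceFillingLaws D.carrier A B fun δ => lawAt (X δ) D.carrier δ (A δ) (B δ))
    (hmiss : ∀ Γ : (ℝ≥0 → ℝ) → CurveClass ℂ, IsSLECurve ((8 : ℝ≥0) / 3) D Γ →
      ∃ z : ℂ, ∃ r : ℝ, 0 < r ∧ ball z r ⊆ D.carrier ∧
        Literature.Probability.Process.preWienerMeasure {ω | Disjoint (ball z (2 * r)) (Γ ω).range} ≠ 0)
    (hW : Literature.Probability.Process.isProjectiveLimit_preWienerMeasure) :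
    ¬ SAWScalingLimitAlong X :=
  fun h => hfill.not_convergesInLawToSLE hmiss hW (h D A B hAB)

end Core

/-! ### A countable family of test balls -/

/-- Test balls: centre the `i`-th point of a dense sequence, radius `1/(n+1)`, indexed by
`j = Nat.pair i n`. [folklore] -/
def testBall (j : ℕ) : Set ℂ :=
  ball (TopologicalSpace.denseSeq ℂ (Nat.unpair j).1) (1 / ((Nat.unpair j).2 + 1 : ℝ))

/-- Every nonempty open set contains a test ball. [folklore] -/
theorem exists_testBall_subset {U : Set ℂ} (hU : IsOpen U) (hne : U.Nonempty) :
    ∃ j, testBall j ⊆ U := by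
  obtain ⟨z, hz⟩ := hne
  obtain ⟨r, hr, hzr⟩ := Metric.isOpen_iff.1 hU z hz
  -- a dense point within `r/3` of `z` and a radius `1/(n+1) < r/3`
  obtain ⟨n, hn⟩ := exists_nat_one_div_lt (show 0 < r / 3 by positivity)
  have hdense := TopologicalSpace.denseRange_denseSeq ℂ
  obtain ⟨i, hi⟩ : ∃ i, TopologicalSpace.denseSeq ℂ i ∈ ball z (r / 3) :=
    hdense.exists_mem_open isOpen_ball ⟨z, mem_ball_self (by positivity)⟩
  refine ⟨Nat.pair i n, fun y hy => hzr ?_⟩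
  rw [testBall, Nat.unpair_pair] at hy
  rw [mem_ball] at hi hy ⊢
  calc dist y z ≤ dist y (TopologicalSpace.denseSeq ℂ i) + dist (TopologicalSpace.denseSeq ℂ i) z :=
        dist_triangle _ _ _
    _ < r / 3 + r / 3 := add_lt_add (hy.trans hn) hi
    _ < r := by linarith

/-- Space-filling reduces to the test balls contained in the domain. [folklore] -/
theorem isSpaceFillingLaws_of_testBall {Ω : Set ℂ} {A B : ℝ → Site 2}
    {P : ∀ δ : ℝ, Measure (DomainSAW Ω δ (A δ) (B δ))}
    (h : ∀ j, testBall j ⊆ Ω →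
      Tendsto (fun δ : ℝ => P δ {γ | ∀ v ∈ γ.walk.support, meshPoint δ v ∉ testBall j}) (𝓝[>] 0) (𝓝 0)) :
    IsSpaceFillingLaws Ω A B P := by
  intro U hU hUΩ hne
  obtain ⟨j, hj⟩ := exists_testBall_subset hU hne
  refine tendsto_of_tendsto_of_tendsto_of_le_of_le' tendsto_const_nhds (h j (hj.trans hUΩ))
    (Eventually.of_forall fun δ => zero_le) (Eventually.of_forall fun δ => ?_)
  exact measure_mono fun γ hγ v hv hvj => hγ v hv (hj hvj)

/-! ### The diagonal schedule -/

section Diagonal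

variable {A B : ℝ → Site 2}

/-- The avoidance probability of the `j`-th test ball at fugacity `x` and mesh `δ`. [folklore] -/
def avoidProb (A B : ℝ → Site 2) (x : ℝ) (j : ℕ) (δ : ℝ) : ℝ≥0∞ :=
  lawAt x unitDisk δ (A δ) (B δ) {γ | ∀ v ∈ γ.walk.support, meshPoint δ v ∉ testBall j}

/-- **Thresholds.** If for every `k` the laws at `x_k` are space-filling, then there are
thresholds `t k > 0` below which the first `k + 1` test balls inside `𝔻` are avoided with
probability `≤ 1/(k+1)` at fugacity `x_k`. [folklore] -/
theorem exists_thresholds {x : ℕ → ℝ} (hfill : ∀ k, IsSpaceFillingFamily (x k) unitDisk A B) :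
    ∃ t : ℕ → ℝ, (∀ k, 0 < t k) ∧ ∀ k, ∀ δ ∈ Ioo 0 (t k), ∀ j ≤ k, testBall j ⊆ unitDisk →
      avoidProb A B (x k) j δ ≤ ENNReal.ofReal (1 / (k + 1)) := by
  have key : ∀ k, ∃ tk : ℝ, 0 < tk ∧ ∀ δ ∈ Ioo 0 tk, ∀ j ≤ k, testBall j ⊆ unitDisk →
      avoidProb A B (x k) j δ ≤ ENNReal.ofReal (1 / (k + 1)) := by
    intro k
    have hev : ∀ᶠ δ in 𝓝[>] (0 : ℝ), ∀ j ∈ Finset.range (k + 1), testBall j ⊆ unitDisk →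
        avoidProb A B (x k) j δ ≤ ENNReal.ofReal (1 / (k + 1)) := by
      rw [eventually_all_finset]
      intro j _
      by_cases hj : testBall j ⊆ unitDisk
      · have ht := hfill k (testBall j) isOpen_ball hj ⟨_, mem_ball_self (by positivity)⟩
        have hpos : (0 : ℝ≥0∞) < ENNReal.ofReal (1 / (k + 1)) := ENNReal.ofReal_pos.2 (by positivity)
        filter_upwards [ht.eventually (Iic_mem_nhds hpos)] with δ hδ _ using hδ
      · exact Eventually.of_forall fun δ h => absurd h hj
    obtain ⟨tk, htk, h⟩ := (nhdsGT_basis (0 : ℝ)).eventually_iff.1 hev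
    exact ⟨tk, htk, fun δ hδ j hj hjD => h hδ j (Finset.mem_range.2 (Nat.lt_succ_of_le hj)) hjD⟩
  choose t ht h using key
  exact ⟨t, ht, h⟩

/-- **The diagonal schedule.** From space-filling at every `x_k ↓ x_c` (a sequence with
`x_k > x_c`, `x_k → x_c`), a schedule `X(δ) ∈ {x_k}` with `X(δ) → x_c`, `X > x_c`, along which
the laws in the unit disk are still space-filling. [folklore] -/
theorem exists_schedule_isSpaceFillingLaws {x : ℕ → ℝ} (hxc : ∀ k, criticalFugacity < x k)
    (hxlim : Tendsto x atTop (𝓝 criticalFugacity))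
    (hfill : ∀ k, IsSpaceFillingFamily (x k) unitDisk A B) :
    ∃ X : ℝ → ℝ, (∀ δ, criticalFugacity < X δ) ∧ Tendsto X (𝓝[>] 0) (𝓝 criticalFugacity) ∧
      IsSpaceFillingLaws unitDisk A B fun δ => lawAt (X δ) unitDisk δ (A δ) (B δ) := by
  classical
  obtain ⟨t, ht, hbound⟩ := exists_thresholds hfill
  -- decreasing thresholds `s k ≤ min (1/(k+1)) (t k)`
  let s : ℕ → ℝ := fun k => min (1 / ((k : ℝ) + 1)) ((Finset.range (k + 1)).inf' (by simp) t)
  have hs_pos : ∀ k, 0 < s k := fun k =>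
    lt_min (by positivity) ((Finset.lt_inf'_iff _).2 fun i _ => ht i)
  have hs_le_t : ∀ k, s k ≤ t k := fun k =>
    (min_le_right _ _).trans (Finset.inf'_le _ (Finset.mem_range.2 (Nat.lt_succ_self k)))
  have hs_le_inv : ∀ k, s k ≤ 1 / ((k : ℝ) + 1) := fun k => min_le_left _ _
  have hs_anti : ∀ {k k'}, k' ≤ k → s k ≤ s k' := by
    intro k k' hkk'
    refine le_min ((hs_le_inv k).trans ?_) ((min_le_right _ _).trans ?_)
    · exact one_div_le_one_div_of_le (by positivity) (by exact_mod_cast Nat.succ_le_succ hkk')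
    · exact Finset.inf'_mono _ (Finset.range_mono (Nat.succ_le_succ hkk')) _
  -- for `δ > 0` some threshold is below `δ` (they tend to `0`)
  have hex : ∀ δ : ℝ, 0 < δ → ∃ k, s k ≤ δ := fun δ hδ => by
    obtain ⟨k, hk⟩ := exists_nat_one_div_lt hδ
    exact ⟨k, (hs_le_inv k).trans hk.le⟩
  -- `K δ` = least index with `s K ≤ δ`; the schedule uses the previous index
  let K : ℝ → ℕ := fun δ => if h : 0 < δ then Nat.find (hex δ h) else 0
  let X : ℝ → ℝ := fun δ => x (K δ - 1)
  have hK_spec : ∀ {δ}, 0 < δ → s (K δ) ≤ δ := fun {δ} hδ => by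
    simp only [K, dif_pos hδ]; exact Nat.find_spec (hex δ hδ)
  have hK_min : ∀ {δ} (hδ : 0 < δ) {k}, k < K δ → δ < s k := fun {δ} hδ {k} hk => by
    simp only [K, dif_pos hδ] at hk
    exact not_le.1 (Nat.find_min (hex δ hδ) hk)
  -- below `s N`, the index is larger than `N`
  have hK_large : ∀ {δ} (hδ : 0 < δ) {N : ℕ}, δ < s N → N < K δ := fun {δ} hδ {N} hN => by
    by_contra hle
    push Not at hle
    have h1 : s N ≤ s (K δ) := hs_anti hle
    have h2 : s (K δ) ≤ δ := hK_spec hδ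
    linarith
  refine ⟨X, fun δ => hxc _, ?_, ?_⟩
  · -- `X δ → x_c`: for `δ < s N`, `X δ = x k` with `k ≥ N`
    rw [Metric.tendsto_nhds]
    intro ε hε
    obtain ⟨N, hN⟩ := (Metric.tendsto_atTop.1 hxlim) ε hε
    filter_upwards [Ioo_mem_nhdsGT (hs_pos N)] with δ hδ
    exact hN _ (Nat.le_sub_one_of_lt (hK_large hδ.1 hδ.2))
  · -- space-filling along `X`, tested on the balls inside `𝔻`
    refine isSpaceFillingLaws_of_testBall fun j hjD => ?_
    rw [ENNReal.tendsto_nhds_zero]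
    intro ε hε
    -- choose `N ≥ j` with `1/(N+1) ≤ ε` (if `ε = ∞` anything works)
    obtain ⟨N, hNj, hNε⟩ : ∃ N, j ≤ N ∧ ENNReal.ofReal (1 / ((N : ℝ) + 1)) ≤ ε := by
      rcases eq_or_ne ε ⊤ with rfl | hεtop
      · exact ⟨j, le_rfl, le_top⟩
      obtain ⟨n, hn⟩ := exists_nat_one_div_lt (ENNReal.toReal_pos hε.ne' hεtop)
      refine ⟨max j n, le_max_left _ _, ?_⟩
      rw [← ENNReal.ofReal_toReal hεtop]
      refine ENNReal.ofReal_le_ofReal ((one_div_le_one_div_of_le (by positivity) ?_).trans hn.le)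
      exact_mod_cast Nat.succ_le_succ (le_max_right j n)
    filter_upwards [Ioo_mem_nhdsGT (hs_pos N)] with δ hδ
    have hδ0 : 0 < δ := hδ.1
    have hKN : N < K δ := hK_large hδ0 hδ.2
    set k := K δ - 1 with hk
    have hk1 : k < K δ := by omega
    have hNk : N ≤ k := by omega
    have hδk : δ ∈ Ioo 0 (t k) := ⟨hδ0, (hK_min hδ0 hk1).trans_le (hs_le_t k)⟩
    have hb := hbound k δ hδk j (hNj.trans hNk) hjD
    refine hb.trans ((ENNReal.ofReal_le_ofReal ?_).trans hNε)
    exact one_div_le_one_div_of_le (by positivity) (by exact_mod_cast Nat.succ_le_succ hNk)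

end Diagonal

/-! ### Theorem 1 reaches into shrinking windows: a blocked window `w₀(δ) → 0` -/

/-- **From Theorem 1: a supercritical schedule `X(δ) → x_c⁺` along which the SAW in the unit
disk is space-filling and (given the SLE_{8/3} facts) does not converge to SLE_{8/3}.** The
schedule is a diagonal through `x_k = x_c + 1/(k+1)`; its rate is inexplicit (it is governed by
the thresholds of Theorem 1, i.e. by `m(x)`, `ξ(x)`, `c(x)` as `x ↓ x_c`).
[cite: DuminilCopinKozmaYadin2014, Theorem 1] -/
theorem exists_schedule_not_sawScalingLimitAlong (h61 : sle_restriction_eightThirds)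
    (h₆ : ae_isSimpleTrace_sleTrace_of_le_four (κ := (8 : ℝ≥0) / 3)) :
    ∃ X : ℝ → ℝ, (∀ δ, criticalFugacity < X δ) ∧ Tendsto X (𝓝[>] 0) (𝓝 criticalFugacity) ∧
      ¬ SAWScalingLimitAlong X := by
  obtain ⟨A, hA⟩ := exists_closestSiteFamily (1 : ℂ)
  obtain ⟨B, hB⟩ := exists_closestSiteFamily (-1 : ℂ)
  have hAB : ∀ δ : ℝ, 0 < δ →
      IsClosestSite unitDisk δ 1 (A δ) ∧ IsClosestSite unitDisk δ (-1) (B δ) :=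
    fun δ hδ => ⟨hA δ hδ, hB δ hδ⟩
  have hne : (1 : ℂ) ≠ -1 := fun h => by
    have h' := congrArg Complex.re h
    norm_num at h'
  set x : ℕ → ℝ := fun k => criticalFugacity + 1 / ((k : ℝ) + 1) with hx
  have hxc : ∀ k, criticalFugacity < x k := fun k => by
    simp only [hx]
    exact lt_add_of_pos_right _ (by positivity)
  have hxlim : Tendsto x atTop (𝓝 criticalFugacity) := by
    have := tendsto_one_div_add_atTop_nhds_zero_nat.const_add criticalFugacity
    simpa [hx] using this
  have hfill : ∀ k, IsSpaceFillingFamily (x k) unitDisk A B := fun k =>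
    isSpaceFillingFamily_of_DKY2014_thm1 DKY2014_thm1_holds (a := 1) (b := -1) norm_one (by simp) hne
      hAB (hxc k)
  obtain ⟨X, hXc, hXlim, hXfill⟩ := exists_schedule_isSpaceFillingLaws hxc hxlim hfill
  refine ⟨X, hXc, hXlim, ?_⟩
  exact not_sawScalingLimitAlong_of_isSpaceFillingLaws (D := DobrushinDomain.unitDisc)
    (isEndpointApprox_unitDisc_of_isClosestSite hAB) hXfill
    (fun _ hΓ => hΓ.exists_ball_measure_disjoint_ne_zero h61 h₆)
    isProjectiveLimit_preWienerMeasure_holds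

/-- **A window shrinking to `0` that Theorem 1 still blocks**: with `w₀ = X - x_c` for the
diagonal schedule, `w₀ > 0`, `w₀(δ) → 0`, and `¬ WindowRobustSAWScalingLimit w₀` (given the
SLE_{8/3} facts); by antitonicity every window eventually `≥ w₀` is blocked as well. So the
reach of the barrier into shrinking windows is a question of RATE: between this inexplicit
`w₀` and the provably harmless `o(δ²)`. [cite: DuminilCopinKozmaYadin2014, Theorem 1] -/
theorem exists_window_tendsto_zero_not_windowRobust (h61 : sle_restriction_eightThirds)
    (h₆ : ae_isSimpleTrace_sleTrace_of_le_four (κ := (8 : ℝ≥0) / 3)) :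
    ∃ w₀ : ℝ → ℝ, (∀ δ, 0 < w₀ δ) ∧ Tendsto w₀ (𝓝[>] 0) (𝓝 0) ∧
      ∀ w : ℝ → ℝ, (∀ᶠ δ in 𝓝[>] (0 : ℝ), w₀ δ ≤ w δ) → ¬ WindowRobustSAWScalingLimit w := by
  obtain ⟨X, hXc, hXlim, hX⟩ := exists_schedule_not_sawScalingLimitAlong h61 h₆
  refine ⟨fun δ => X δ - criticalFugacity, fun δ => sub_pos.2 (hXc δ), ?_, fun w hw h => hX (h X ?_)⟩
  · have := hXlim.sub_const criticalFugacity
    rwa [sub_self] at this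
  · filter_upwards [hw] with δ hδ
    rwa [abs_of_pos (sub_pos.2 (hXc δ))]

end SupercriticalSAW

open SupercriticalSAW

/-- **Barrier `SupercriticalSAWSpaceFillingNarrow`** (the audited, sharper form of
`SupercriticalSAWSpaceFilling`; PROVED below, `SupercriticalSAWSpaceFillingNarrow_holds`): Theorem 1
of Duminil-Copin–Kozma–Yadin (fixed `x > x_c`: supercritical SAWs in the unit disk are
space-filling) together with the statement delimiting what it can obstruct — for every window
`0 ≤ w(δ) = o(δ²)` the window-robust strengthening `WindowRobustSAWScalingLimit w` of the
sub-problem is EQUIVALENT to the sub-problem `Literature.Probability.RandomPlanarGeometry.SAW.SAWScalingLimit`.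

BARRIER (structured block, D-0021):
- technique_class: delta-independent-fugacity-neighbourhood conclusion-robust-in-x (`SupercriticalSAW.RobustSAWScalingLimit` and every `SupercriticalSAW.WindowRobustSAWScalingLimit w` whose window is eventually `≥ η > 0`: an SLE_{8/3} CONCLUSION asserted for all fugacities of a δ-independent neighbourhood, or right-neighbourhood, of `x_c`) [cite: DuminilCopinKozmaYadin2014, Theorem 1]
- blocks: `RobustSAWScalingLimit` (`SupercriticalSAWSpaceFilling.not_robustSAWScalingLimit`, `…Refutation`), `WindowRobustSAWScalingLimit w` for `w ≥ η > 0` eventually (`SupercriticalSAW.not_windowRobustSAWScalingLimit_of_eventually_le`) and for `w ≥ w₀` eventually, `w₀(δ) → 0⁺` an INEXPLICIT diagonal window (`SupercriticalSAW.exists_window_tendsto_zero_not_windowRobust`), all modulo the SLE_{8/3} facts `sle_restriction_eightThirds`, `ae_isSimpleTrace_sleTrace_of_le_four`: for each fixed `x > 1/μ` the walk in `𝔻_δ` leaves no hole of `> c(x) log(1/δ)` sites with probability `→ 1` [cite: DuminilCopinKozmaYadin2014, Theorem 1], hence misses no open set, while SLE_{8/3} misses a ball with positive probability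
- because: Proposition 3 (`limsup_m Z_m(x) = ∞` for fixed `x > 1/μ`, from `e^{-c√n}μⁿ ≤ b_n`) fixes a box size `m = m(x)`; Theorem 6 then bounds `P[hole > λ] ≤ C(x,Ω)δ⁻² e^{-c(x)λ}` with tube radius `6m(x)` — every constant depends on `x` through `m(x)` and nothing is uniform as `x ↓ 1/μ` [cite: DuminilCopinKozmaYadin2014, Proposition 3 and Theorem 6]
- evasions_known: (i) mesh-coordinated near-critical windows `x(δ) → x_c` are outside the theorem: for `x(δ) - x_c = o(δ²)` the fugacity-`x(δ)` law and the critical law have identical limits in law (`SupercriticalSAW.convergesInLawToSLE_along_iff`, proved here; supercritical length is `O(δ⁻²)` [cite: DuminilCopinKozmaYadin2014, §4 (before Problem 9)]), and the conjectural crossover window is `|x - x_c| ≍ δ^{4/3}` (`ν = 3/4` [cite: LawlerSchrammWerner2004SAW, Prediction 2]) where massive SLE / massive parafermionic observables are designed to work, the perturbation being taken "in a coordinated way with the lattice mesh" [cite: MakarovSmirnov2010, §1 and Questions 4.12–4.13] [cite: PriceEtAl2012, Lemmas 2–3]; (ii) ingredients analytic or open in `x` are not obstructed, only `x`-robust conclusions: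 the off-critical identity with mass term `(1 - x/x_c)` holds at every `x` [cite: PriceEtAl2012, Lemma 3], and the source's own polygon-insertion entropy mechanism operates AT `x_c` [cite: DuminilCopinGangulyHammondManolescu2020, Theorems 1.2–1.3]; (iii) the absence of a closed formula for `μ(ℤ²)` obstructs nothing (`x_c` is used symbolically throughout, as in Theorem 1 itself)
- scope_caveats: unit disk with closest-site endpoints, hole-size sense, `ℤ²` (the proof in the tree); general domains only after microscopic expansion (Theorem 2); the schedules covered explicitly are those bounded away from `x_c` from above along `δ → 0` (constant comparison schedules) plus one inexplicit diagonal schedule `X(δ) → x_c⁺` — windows between that inexplicit `w₀(δ)` and `δ²` are decided by NO theorem here (neither blocked nor reduced to the sub-problem; making `w₀` explicit means tracking `m(x)` of Proposition 3 as `x ↓ 1/μ`), and the critical non-space-filling (Problem 10) and the subcritical geodesic picture remain open/unreferenced [cite: DuminilCopinKozmaYadin2014, Theorem 2 and Problem 10]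
- status: established (proved in the tree: `SupercriticalSAWSpaceFillingNarrow_holds`)

[cite: DuminilCopinKozmaYadin2014, Theorem 1] -/
def SupercriticalSAWSpaceFillingNarrow : Prop :=
  SupercriticalSAWSpaceFilling ∧
    ∀ w : ℝ → ℝ, (∀ᶠ δ in 𝓝[>] (0 : ℝ), 0 ≤ w δ) →
      Tendsto (fun δ => w δ / δ ^ 2) (𝓝[>] 0) (𝓝 0) →
        (WindowRobustSAWScalingLimit w ↔ SAWScalingLimit)

/-- **The narrowed barrier holds**: Theorem 1 is `SupercriticalSAWSpaceFilling_holds`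
(`…TilesTheorem6`) and the window clause is `windowRobustSAWScalingLimit_iff`.
[cite: DuminilCopinKozmaYadin2014, Theorem 1] -/
theorem SupercriticalSAWSpaceFillingNarrow_holds : SupercriticalSAWSpaceFillingNarrow :=
  ⟨SupercriticalSAWSpaceFilling_holds, fun _ hw0 hw => windowRobustSAWScalingLimit_iff hw0 hw⟩

end Literature.Barriers.CriticalPhenomena
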